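import Literature.AlgebraicGeometry.Resolution.InseparableLocalUniformizationLemmas
import HarnessLib

/-!
# Temkin's decompletion lemma (Temkin 2013, Lemma 3.3.2): a correction of the tree's rendering

Topic: `Literature/AlgebraicGeometry/Resolution`. M. Temkin, *Inseparable local uniformization*,
J. Algebra 373 (2013) 65–119 = arXiv:0804.1554v3, Lemma 3.3.2 (pp. 45–46; p. 28 of the 41-page
arXiv version held in the literature store, same number). Setting (held version, p. 28):
"Consider the following situation: `X = Spec(A)` is an affine integral `S`-scheme OF NORMALIZED
FINITE PRESENTATION and `x ∈ X_η` is a closed point of the generic fiber. Assume that the finite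
`k`-field `m = k(x)` is provided with a valuation extending that of `k` and such that the closed
immersion `i_x : Spec(m) → X_η` extends to a morphism `i : S_m → X`, where `S_m = Spec(m°)`.
Lemma 3.3.2. Keep the above notation and assume that `x` is a simple `k`-smooth point. Then
there exists an affine `S`-scheme `X′` of normalized finite presentation and a morphism
`f : X′ → X` such that `f_η` is an isomorphism, the closed immersion `i_x : Spec(m) → X′_η`
extends to a lifting `i′ : S_m → X′` of `i`, and the image of the closed point of `S_m` under
`i′` is smooth-equivalent to the closed point of `S_m`." (v3, p. 45: "`X = Spec(A)` is an affine
normal nft `S`-scheme"; nft = normalized finite type, Definition 2.2.4 (i) of the held version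
= 2.2.2 of v3: "a composition of a partial normalization `Y → Y₀` and a morphism `Y₀ → X` of
finite presentation (resp. type)", a partial normalization being `Spec` of an `𝒪`-subalgebra
of the integral closure in the total ring of fractions, §2.2, p. 7.)

## The tree's rendering `Temkin2013_Lemma332` is mis-stated (too strong, in fact refutable)

`Temkin2013_Lemma332` (`InseparableLocalUniformizationLemmas.lean`) renders "`X` is an affine
normal(ized) `S`-scheme" by `IsAffineNormalizedModel ⊤ k° A`, i.e. `A = Nr_K(k°[f₁, …, f_n])`
for finitely many `fᵢ ∈ K` and `Frac A = K`. This does NOT say that `X → S` is of normalized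
finite type: nothing ties `K` to the fraction field `Frac(k°[f₁, …, f_n])`, over which `K` may be
an INFINITE algebraic extension (e.g. `n = 0`, `K` any algebraic extension of `k`,
`A = Nr_K(k°)`); then the generic fibre `X_η = Spec k[A]` is not of finite type over `k` and
`m = k(x)` is not finite over `k` — whereas the printed hypothesis "normalized finite
presentation" forces `K = Frac(A₀)` for a finitely generated `k°`-algebra `A₀ ⊆ A`, and all of
Temkin's conclusions and proof ("`m̂` is finite over `k̂`", "`x̂` is Zariski closed") live in that
finite situation. The rendered `Prop` is in fact FALSE — PROVED: `not_temkin2013_Lemma332`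
(`InseparableLocalUniformizationDecompletionRefutation.lean`; counterexample in characteristic
zero: `k = ℚ(X)` with the `X`-adic valuation, `K = Frac k[ℚ] = k(t^q : q ∈ ℚ)`,
`A = Nr_K(k°[t, t⁻¹])`, `m = k`, `x` the augmentation point `t^q ↦ 1`, `m° = k°`: a finitely
presented `k[ℚ]`-algebra of finite type over `k` is zero, so no refinement `A′` carries a common
smooth cover with `Spec k°`). A different, arithmetic counterexample (not formalized):
`k = 𝔽_p(t)` with the `t`-adic valuation (height one, equicharacteristic), `K = m = kˢᵉᵖ`,
`A = Nr_K(k°)`, `φ = id` (so `x = 0`; `K/k` separable algebraic is formally smooth, Mathlib's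
`Algebra.FormallyEtale.of_isSeparable`, hence `IsSmoothAt`), `m° = Om` any extension of `k°` to
`K`. Every admissible `A′ = Nr_K(k°[g₁, …, g_r]) ⊆ Om` is a one-dimensional Prüfer domain whose
closed points are the extensions `V ⊇ k°[g]` of the valuation to `K`, its local ring at the centre
of `Om` is `Om`, and every neighbourhood of that centre contains infinitely many closed points
(no finite extension of the global field `k(g)` is henselian). If `D` were smooth over `A′` and
over `Om` (compatibly over `k°`) with a prime over both closed points, the image of
`Spec D → Spec A′` would be open (flat, finitely presented), hence contain infinitely many
`V_i`; the minimal primes of `D` lie over the generic point of `Om` (flatness), so they are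
finitely many and one of them, `𝔮`, lies below primes `rᵢ` over infinitely many `Vᵢ`; in the
field `L = Frac(D/𝔮)` the copy `σ₁(K) ⊇ σ₁(A′)` of `K`, being separable algebraic over
`σ₁(k) = σ₂(k)`, lies in the separably closed copy `σ₂(K) ⊇ σ₂(Om)`, i.e. `σ₁ = σ₂ ∘ τ` for one
`τ ∈ Gal(K/k)`; a valuation ring of `L` dominating `(D/𝔮)_{rᵢ}` restricts to `σ₁(Vᵢ)` on
`σ₁(K)` and to `σ₂(Om)` on `σ₂(K)`, whence `Vᵢ = τ⁻¹(Om)` for all `i` — contradiction. (So every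
theorem taking `(h : Temkin2013_Lemma332)` is vacuous; the one user in the tree,
`relConclusion_of_normalForm` of `InseparableLocalUniformizationHeightStepTwo.lean`, has the
finiteness needed to use the corrected fact below instead.)

## Contents

* `Temkin2013_Lemma332_nft` — NAMED FACT, the corrected rendering: `Temkin2013_Lemma332` with
  the ONE missing hypothesis added, "`X → S` is of normalized finite type", rendered (given
  `IsAffineNormalizedModel ⊤ k° A`: `A = Nr_K(k°[s])`, `Frac A = K`) by its equivalent
  "`K/k` is a finitely generated field extension", `(⊤ : IntermediateField k K).FG`, exactly as in
  `Temkin2013RelativeCurve` (Thm. 3.3.1): then `K`, being finitely generated over `k` and algebraic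
  over `k(s)`, is finite over `k(s)`, so `A = Nr_K(k°[s ∪ t])` for finitely many further `t ∈ A`
  with `Frac(k°[s ∪ t]) = K`, i.e. `X = Spec A` is the normalization of the finitely presented
  (Nagata: finite type and flat over a valuation ring) affine `S`-scheme `Spec k°[s ∪ t]` — an
  affine integral `S`-scheme of normalized finite presentation, as printed; conversely nft forces
  `K = Frac(A₀)` finitely generated over `k`. All other data, hypotheses and the conclusion are
  those of `Temkin2013_Lemma332` verbatim (see its docstring for the dictionary), in particular
  the base is equicharacteristic of height one as there.
* `Temkin2013_Lemma332_nft.of_lemma332` — PROVED (trivial): the tree's rendering implies the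
  corrected one (it has fewer hypotheses), so that existing reductions from
  `Temkin2013_Lemma332` transfer.

## On proving `Temkin2013_Lemma332_nft`

The printed proof is Berkovich-analytic (completion `𝒜 = Â_π`, [Ber2, 3.3.6 and 3.4.1]: the
étale morphism given by a regular system of parameters at the smooth `m̂`-point `x̂` is locally
the projection `𝔸ⁿ_{m̂} → 𝔸ⁿ_{k̂}`, Weierstrass domains, and Thm. 2.8.2 (ii), itself resting on the analytic criterion of
étaleness of §2.6); none of this exists in Lean. An algebraic route replacing the
analytic local structure by an explicit standard-étale chart at finite level and the analytic
étaleness criterion by the "critère de platitude par fibres" (Stacks Project, Tags 00R7/05UV),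
Nagata's finite presentation of flat finite type algebras over valuation rings (Tag 053E), the
local structure of étale algebras and the commutation of integral closure with smooth base
change (both in Mathlib: `Algebra.IsEtaleAt.exists_isStandardEtale`,
`TensorProduct.toIntegralClosure_bijective_of_smooth`) and `Temkin2013_valuationRingOpen`
(`ValuationRingOpenInNormalization.lean`) is recorded in the prover's notes; it is not carried
out in this file.

## Sources

* M. Temkin, *Inseparable local uniformization*, J. Algebra 373 (2013) 65–119 =
  arXiv:0804.1554v3, Lemma 3.3.2 and its proof (pp. 45–46); §2.2 (normalized finite
  type/presentation); held arXiv version (41 pp.): Lemma 3.3.2, p. 28; Definition 2.2.4, p. 8.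
-/

noncomputable section

open IsLocalRing

namespace Literature.AlgebraicGeometry.Resolution

universe u

/-- NAMED FACT (corrected rendering of Temkin 2013, Lemma 3.3.2) — **Temkin's decompletion
lemma for simple smooth closed points of the generic fibre of an affine normal `S`-scheme OF
NORMALIZED FINITE TYPE** (held arXiv version p. 28 = v3 pp. 45–46: "`X = Spec(A)` is an affine
integral `S`-scheme of normalized finite presentation and `x ∈ X_η` is a closed point of the
generic fiber. Assume that the finite `k`-field `m = k(x)` is provided with a valuation extending
that of `k` and such that the closed immersion `i_x : Spec(m) → X_η` extends to a morphism
`i : S_m → X`, where `S_m = Spec(m°)`. Lemma 3.3.2. Keep the above notation and assume that `x`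
is a simple `k`-smooth point. Then there exists an affine `S`-scheme `X′` of normalized finite
presentation and a morphism `f : X′ → X` such that `f_η` is an isomorphism, the closed immersion
`i_x : Spec(m) → X′_η` extends to a lifting `i′ : S_m → X′` of `i`, and the image of the closed
point of `S_m` under `i′` is smooth-equivalent to the closed point of `S_m`."). This is
`Temkin2013_Lemma332` of `InseparableLocalUniformizationLemmas.lean` — same affine rendering
(`k°` of height one and equicharacteristic; `X = Spec A`, `A = Nr_K(k°[f₁, …, f_n]) ⊆ K = Frac A`
via `IsAffineNormalizedModel ⊤`; `X_η = Spec k[A]`; the closed point `x = ker φ` for a surjective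
`k`-algebra map `φ : k[A] → m` onto a field; "simple `k`-smooth" = `IsSmoothAt k x ∧
Algebra.IsSeparable k m`; `i` = "`φ(A) ⊆ m°`"; conclusion: a normalized affine refinement
`A ≤ A′ ≤ k[A]` with `φ(A′) ⊆ m°` whose centre `φ⁻¹(𝔪_{m°}) ∩ A′` is smooth-equivalent over
`k°` (`AreSmoothEquivalent`, Definition 2.8.1) to the closed point of `Spec m°`) — WITH THE
PRINTED FINITENESS HYPOTHESIS RESTORED: "`X` is of normalized finite type over `S`", i.e. (given
`A = Nr_K(k°[f])`, `Frac A = K`) "`K/k` is a finitely generated field extension",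
`(⊤ : IntermediateField k K).FG`. The tree's `Temkin2013_Lemma332` omits it, which allows `K`
to be an infinite algebraic extension of `Frac(k°[f])` (`X_η` not of finite type, `m/k` infinite)
and makes that `Prop` false (module docstring: `k = 𝔽_p(t)`, `K = m = kˢᵉᵖ`, `A = Nr_K(k°)`).
The printed proof is Berkovich-analytic ([Ber2, 3.3.6/3.4.1], Weierstrass domains, Thm. 2.8.2
(ii)); not reproduced. Users take `(h : Temkin2013_Lemma332_nft)`.
[cite: Temkin2013, Lemma 3.3.2 and its proof (arXiv:0804.1554v3 pp. 45–46)] -/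
def Temkin2013_Lemma332_nft : Prop :=
  ∀ (k K : Type u) [Field k] [Field K] [Algebra k K] (Ok : ValuationSubring k),
    ringChar (IsLocalRing.ResidueField Ok) = ringChar k → ringKrullDim Ok = 1 →
  ∀ (A : Subring K), IsAffineNormalizedModel ⊤ (Ok.toSubring.map (algebraMap k K)) A →
    (⊤ : IntermediateField k K).FG →
  ∀ (m : Type u) [Field m] [Algebra k m] (φ : Algebra.adjoin k (A : Set K) →ₐ[k] m),
    Function.Surjective φ →
  ∀ (x : Ideal (Algebra.adjoin k (A : Set K))) [x.IsPrime],
    RingHom.ker (φ : Algebra.adjoin k (A : Set K) →+* m) = x →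
    Algebra.IsSmoothAt k x → Algebra.IsSeparable k m →
  ∀ (Om : ValuationSubring m), Om.comap (algebraMap k m) = Ok →
    (∀ a : A, φ ⟨a, Algebra.subset_adjoin a.2⟩ ∈ Om) →
    ∃ (A' : Subring K), A ≤ A' ∧ IsAffineNormalizedModel ⊤ (Ok.toSubring.map (algebraMap k K)) A' ∧
      ∃ (hA' : ∀ a ∈ A', a ∈ Algebra.adjoin k (A : Set K))
        (hi' : ∀ a : A', φ ⟨a, hA' a a.2⟩ ∈ Om)
        (hkA' : ∀ c : Ok, algebraMap k K c ∈ A') (hkm : ∀ c : Ok, algebraMap k m c ∈ Om),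
        AreSmoothEquivalent
          (((algebraMap k K).comp Ok.subtype).codRestrict A' hkA')
          (((algebraMap k m).comp Ok.subtype).codRestrict Om hkm)
          ((IsLocalRing.maximalIdeal Om).comap
            (liftToValuationSubring (Algebra.adjoin k (A : Set K)) φ A' hA' Om hi'))
          (IsLocalRing.maximalIdeal Om)

-- `Temkin2013_Lemma332` is `@[deprecated]` (mis-rendered, refuted; 2026-08-15) and this record of the implication must name it;
-- REMOVE-WHEN the deprecated def is deleted from `InseparableLocalUniformizationLemmas.lean`.
set_option linter.deprecated false in
/-- The tree's rendering `Temkin2013_Lemma332` (no finiteness hypothesis) trivially implies the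
corrected rendering `Temkin2013_Lemma332_nft` (one more hypothesis), so reductions from the
former transfer to the latter. (The converse fails: `Temkin2013_Lemma332` is false,
`not_temkin2013_Lemma332` in `InseparableLocalUniformizationDecompletionRefutation.lean`; see the
module docstring.) [folklore] -/
theorem Temkin2013_Lemma332_nft.of_lemma332 (h : Temkin2013_Lemma332.{u}) :
    Temkin2013_Lemma332_nft.{u} := by
  intro k K _ _ _ Ok hchar hdim A hA _ m _ _ φ hφ x _ hker hsm hsep Om hOm hi
  exact h k K Ok hchar hdim A hA m φ hφ x hker hsm hsep Om hOm hi

end Literature.AlgebraicGeometry.Resolution
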